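import Summits.QuantumFields.YangMills.Theorems.BalabanUVNodesN19TiltedPriceClosedWindow

/-!
# YM-DAG node N19 (= NE7 proper) — THE TILTED PRICE, closed-window faces II: the Markov binder is SUMMABLE for geometric (indeed `Σ√δ < ∞`)
# remainders; the converse of the join WITHOUT window shrink

Cell `pub-ymgap`, HUMAN RULING D-0062 (Track A), R141 (C) wider-strategy seat `pub-ymgap-dag-n19-e` (strategy s3 = ALTERNATIVE CURRENCY), generation
g15, module 5 (sibling of p531657 `…N19TiltedPriceClosedWindow`).  Route `Summits/QuantumFields/YangMills/Theses/BalabanUVNodes.lean` rev 22 (commit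
2d048f7e82a7; retriage rev 23 318081ca5acb), cluster item K3⁶ «SpineGivenEndpointR13SepCoPR» (stmt-QuantumFields-20509; dag-lead WORDS-142); filed `--supports` that item `--as helper`
(it proves no registered stub; record-token-free).  COUNT-NEUTRAL: bookkeeping BY NAME over p531657 (`tiltedMeanMatching_of_core_closedWindow`,
`sqlogPrice_le`), p497552 `…N19MGFJoinConverse` (`coreZero_of_core`; its `tiltedMeanMatching_summable_of_core(_geometric)` and
`coreZero_tiltedMeanMatching_of_coreEdge` are the theorems un-shrunk here), p477267 `…N19ExpectationCurrencyAtScheme` (`summable_sqrt_of_le_geometric`),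
`DressedMGFForm` (`MGFForm`, `TiltedMeanMatching`); NOT a discharge claim.

WHAT IT SAYS.  The consumers of N14's binder take the SHAPE `∃ η, TiltedMeanMatching l₀ T Bad F ν F′ ν′ η ∧ Summable η` (e.g. `…N14YoungRateByName`).
p531657's same-window binder has `η_K = C(l₀, B)·volδ_K·(1 + log⁺(2volδ_K)⁻¹)²∕log²(e + log⁺(2volδ_K)⁻¹)` — the Markov price.  §1: this price is summable
as soon as `Σ volδ_K < ∞` AND `Σ √(volδ_K) < ∞` (termwise `δ·(1 + L)²∕log²(e + L) ≤ 2δ + 32√(2δ)`, p531657's `sqlogPrice_le`), in particular for GEOMETRIC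
remainders `0 ≤ δ_K ≤ C·θ^K`, `0 ≤ θ < 1` — the budget road's (p453434) and every rate producer's class.  §2: ★ `tiltedMeanMatching_summable_of_core_closedWindow`
(`∃ η, TiltedMeanMatching l₀ … η ∧ Summable η` from MGF-form cores + `NE7.Core l₀ vol T Bad P Q δ` + `Σ volδ, Σ√(volδ) < ∞`), `…_geometric`, and
★★ `coreZero_tiltedMeanMatching_of_coreEdge_closedWindow` — THE CONVERSE OF THE JOIN WITHOUT WINDOW SHRINK: MGF forms + `∃ δ ≥ 0, NE7.Core l₀ vol T Bad P Q δ ∧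
Σ volδ_K < ∞ ∧ Σ √(volδ_K) < ∞` (`0 < vol`, classes good uniformly on the window) ⇒ a vacuum core ON `l₀` with summable remainder AND `TiltedMeanMatching l₀`
with summable `η` (p497552: on every inner window `l₁ < l₀`, summability class `Σ volδ(1 + log⁺(volδ)⁻¹) < ∞`).  So for ONE bounded observable the pair
(V)+(I) of road (ii) is necessary and sufficient for NE7-proper ON THE SAME WINDOW, up to the summability class (`Σ√δ` vs `Σδ`; both met by geometric `δ`).

KERNEL-CHECKED (0 `def`, 0 `sorry`): §1 `summable_sqlog_of_summable_sqrt`, `summable_sqlog_of_le_geometric` · §2 ★ `tiltedMeanMatching_summable_of_core_closedWindow`,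
`tiltedMeanMatching_summable_of_core_closedWindow_geometric`, ★★ `coreZero_tiltedMeanMatching_of_coreEdge_closedWindow`, `tiltedMeanMatching_of_pathLeaf_closedWindow`,
`tiltedMeanMatching_of_hybridNE7_closedWindow` (the node's shape `HybridNE7` ⇒ N14's binder on the node's own window `l₀`).
NOT claimed: summability of the Markov binder under `Σ volδ(1 + log⁺(volδ)⁻¹)² < ∞` alone (true; the `√`-class is what the tree's producers deliver).

HONEST FRAMING (binding).  Bookkeeping; located consumer SHAPE only (no ask on the bus).  Nothing of [Balaban1987RG1]–[Balaban1989LargeFieldII] or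
[King1986] is asserted, quoted or instantiated; `Core` is a HYPOTHESIS; NE7 ∕ NE7b ∕ NE7c NOT PRINTED, NOT proved; N19 NOT discharged; Track A count unmoved
(typed 28∕28 · discharged 5∕27 · A 5∕28).  One finite `T⁴` programme at fixed `ε`; nothing continuum ∕ `ℝ⁴` ∕ OS ∕ mass-gap ∕ Clay.  THEOREMS ONLY; standard
axioms; no cite tags.
-/

set_option autoImplicit false

noncomputable section

open Set Filter Topology MeasureTheory ProbabilityTheory

namespace Summit.QuantumFields.YangMills.Theorems.BalabanUVNodesN19TiltedPriceClosedWindowSummable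

open Literature.MathematicalPhysics.QuantumFieldTheory.Balaban1983to89
open Summit.QuantumFields.BalabanUV.T4Continuum.Spine
open Summit.QuantumFields.BalabanUV.T4Continuum.NE1p.DressedMGFForm (MGFForm TiltedMeanMatching)
open Summit.QuantumFields.YangMills.BalabanUVNodes.N19MGFJoinConverse (coreZero_of_core)
open Summit.QuantumFields.YangMills.BalabanUVNodes.N19ExpectationCurrencyAtScheme (summable_sqrt_of_le_geometric)
open Summit.QuantumFields.YangMills.Theorems.BalabanUVNodesN19TiltedPriceClosedWindow (sqlogPrice_le tiltedMeanMatching_of_core_closedWindow)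

/-! ## §1 The Markov price is summable in the `√`-class [folklore] -/

/-- `Σ δ_K < ∞` and `Σ √δ_K < ∞` (`δ ≥ 0`) ⇒ `Σ C·δ_K·(1 + log⁺(2δ_K)⁻¹)²∕log²(e + log⁺(2δ_K)⁻¹) < ∞` (`0 ≤ C`; termwise `≤ C·(2δ + 32√(2δ))`,
`√(2δ) = √2·√δ`). [folklore] -/
theorem summable_sqlog_of_summable_sqrt {δ : ℕ → ℝ} (hδ : ∀ K, 0 ≤ δ K) (h1 : Summable δ)
    (h2 : Summable fun K => Real.sqrt (δ K)) {C : ℝ} (hC : 0 ≤ C) :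
    Summable fun K => C * δ K * (1 + Real.posLog (2 * δ K)⁻¹) ^ 2 / Real.log (Real.exp 1 + Real.posLog (2 * δ K)⁻¹) ^ 2 := by
  have hmaj : Summable fun K => C * (2 * δ K + 32 * Real.sqrt (2 * δ K)) := by
    have e : ∀ K, Real.sqrt (2 * δ K) = Real.sqrt 2 * Real.sqrt (δ K) := fun K => Real.sqrt_mul zero_le_two _
    simp_rw [e]
    exact ((h1.mul_left 2).add ((h2.mul_left (Real.sqrt 2)).mul_left 32)).mul_left C
  refine Summable.of_nonneg_of_le (fun K => ?_) (fun K => sqlogPrice_le (hδ K) hC) hmaj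
  have := hδ K
  have : 0 ≤ Real.posLog (2 * δ K)⁻¹ := Real.posLog_nonneg
  positivity

/-- GEOMETRIC remainders pay the Markov price: `0 ≤ δ_K ≤ C₀·θ^K`, `0 ≤ θ < 1` ⇒ `Σ C·δ_K·(1 + log⁺(2δ_K)⁻¹)²∕log²(e + log⁺(2δ_K)⁻¹) < ∞`
(`summable_sqrt_of_le_geometric` BY NAME). [folklore] -/
theorem summable_sqlog_of_le_geometric {δ : ℕ → ℝ} {C₀ θ : ℝ} (hδ : ∀ K, 0 ≤ δ K) (hθ : 0 ≤ θ) (hθ1 : θ < 1)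
    (hle : ∀ K, δ K ≤ C₀ * θ ^ K) {C : ℝ} (hC : 0 ≤ C) :
    Summable fun K => C * δ K * (1 + Real.posLog (2 * δ K)⁻¹) ^ 2 / Real.log (Real.exp 1 + Real.posLog (2 * δ K)⁻¹) ^ 2 :=
  summable_sqlog_of_summable_sqrt hδ (Summable.of_nonneg_of_le hδ hle ((summable_geometric_of_lt_one hθ hθ1).mul_left C₀))
    (summable_sqrt_of_le_geometric hδ hθ hθ1 hle) hC

/-! ## §2 `Core l₀` with `√`-summable remainder ⇒ N14's binder ON `l₀` with summable `η`; the converse of the join without window shrink -/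

section Leaf

variable {ι : Type*} [DecidableEq ι] {Ω Ω' : ℕ → Type*} [∀ K, MeasurableSpace (Ω K)] [∀ K, MeasurableSpace (Ω' K)]
  {B l₀ vol : ℝ} {T : ℕ → Finset ι} {Bad : ℕ → ℝ → Finset ι} {F : ∀ K, Ω K → ℝ} {ν : ∀ K, ι → Measure (Ω K)}
  {F' : ∀ K, Ω' K → ℝ} {ν' : ∀ K, ι → Measure (Ω' K)} {P Q : ℕ → ℝ → ι → ℝ} {δ : ℕ → ℝ}

/-- ★ **`Core l₀` WITH `Σ volδ, Σ √(volδ) < ∞` ⇒ `∃ η, TiltedMeanMatching l₀ … η ∧ Summable η`** — the consumers' binder shape AT THE PRODUCER'S WINDOW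
(MGF-form cores, `0 < l₀`, `0 ≤ vol`, `0 ≤ δ`, classes good uniformly on the window; p531657's `tiltedMeanMatching_of_core_closedWindow` + §1). [folklore] -/
theorem tiltedMeanMatching_summable_of_core_closedWindow (hP : MGFForm B T F ν P) (hQ : MGFForm B T F' ν' Q)
    (h : NE7.Core l₀ vol T Bad P Q δ) (hl₀ : 0 < l₀) (hvol : 0 ≤ vol) (hδ : ∀ K, 0 ≤ δ K)
    (hBad : ∀ K (t u : ℝ), |t| ≤ l₀ → |u| ≤ l₀ → Bad K u ⊆ Bad K t)
    (h1 : Summable fun K => vol * δ K) (h2 : Summable fun K => Real.sqrt (vol * δ K)) :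
    ∃ η : ℕ → ℝ, TiltedMeanMatching l₀ T Bad F ν F' ν' η ∧ Summable η := by
  refine ⟨_, tiltedMeanMatching_of_core_closedWindow hP hQ h hl₀ hvol hδ hBad, ?_⟩
  have hC : 0 ≤ 64 * Real.exp (2 + 2 * (2 * Real.exp 1 - 1) * l₀ * B) / l₀ := by positivity
  refine (summable_sqlog_of_summable_sqrt (fun K => mul_nonneg hvol (hδ K)) h1 h2 hC).congr fun K => ?_
  field_simp

/-- **… in particular for GEOMETRIC remainders** `0 ≤ δ_K ≤ C·θ^K`, `0 ≤ θ < 1`. [folklore] -/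
theorem tiltedMeanMatching_summable_of_core_closedWindow_geometric (hP : MGFForm B T F ν P) (hQ : MGFForm B T F' ν' Q)
    (h : NE7.Core l₀ vol T Bad P Q δ) (hl₀ : 0 < l₀) (hvol : 0 ≤ vol) (hδ : ∀ K, 0 ≤ δ K)
    (hBad : ∀ K (t u : ℝ), |t| ≤ l₀ → |u| ≤ l₀ → Bad K u ⊆ Bad K t)
    {C θ : ℝ} (hθ : 0 ≤ θ) (hθ1 : θ < 1) (hle : ∀ K, δ K ≤ C * θ ^ K) :
    ∃ η : ℕ → ℝ, TiltedMeanMatching l₀ T Bad F ν F' ν' η ∧ Summable η := by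
  have hδ' : ∀ K, 0 ≤ vol * δ K := fun K => mul_nonneg hvol (hδ K)
  have hle' : ∀ K, vol * δ K ≤ vol * C * θ ^ K := fun K => by
    simpa only [mul_assoc] using mul_le_mul_of_nonneg_left (hle K) hvol
  exact tiltedMeanMatching_summable_of_core_closedWindow hP hQ h hl₀ hvol hδ hBad
    (Summable.of_nonneg_of_le hδ' hle' ((summable_geometric_of_lt_one hθ hθ1).mul_left (vol * C)))
    (summable_sqrt_of_le_geometric hδ' hθ hθ1 hle')

/-- ★★ **THE CONVERSE OF THE JOIN WITHOUT WINDOW SHRINK.**  MGF-form cores `P` (run A), `Q` (run B), `0 < l₀`, `0 < vol`, classes good uniformly on the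
window; if `∃ δ ≥ 0, NE7.Core l₀ vol T Bad P Q δ ∧ Σ volδ_K < ∞ ∧ Σ √(volδ_K) < ∞`, then ON THE SAME WINDOW `l₀` there are a vacuum core with SUMMABLE
remainder AND a `TiltedMeanMatching l₀` with SUMMABLE `η` — the exact hypothesis pair (V)+(I) of the join (`…N19VacuumMGFRoad.coreEdge_of_coreZero_mgfForm`)
recovered from its conclusion with no loss of window (p497552's `coreZero_tiltedMeanMatching_of_coreEdge`: inner windows `l₁ < l₀`; summability class
`Σ volδ(1 + log⁺(volδ)⁻¹)` there, `Σ √(volδ)` here — both met by geometric `δ`). [folklore] -/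
theorem coreZero_tiltedMeanMatching_of_coreEdge_closedWindow (hP : MGFForm B T F ν P) (hQ : MGFForm B T F' ν' Q) (hl₀ : 0 < l₀)
    (hvol : 0 < vol) (hBad : ∀ K (t u : ℝ), |t| ≤ l₀ → |u| ≤ l₀ → Bad K u ⊆ Bad K t)
    (h : ∃ δ : ℕ → ℝ, (∀ K, 0 ≤ δ K) ∧ NE7.Core l₀ vol T Bad P Q δ ∧
      (Summable fun K => vol * δ K) ∧ Summable fun K => Real.sqrt (vol * δ K)) :
    ∃ δ₀ η : ℕ → ℝ, NE7.Core l₀ vol T Bad (fun K _ τ => P K 0 τ) (fun K _ τ => Q K 0 τ) δ₀ ∧ Summable δ₀ ∧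
      TiltedMeanMatching l₀ T Bad F ν F' ν' η ∧ Summable η := by
  obtain ⟨δ, hδ, hcore, h1, h2⟩ := h
  obtain ⟨η, hη, hηs⟩ := tiltedMeanMatching_summable_of_core_closedWindow hP hQ hcore hl₀ hvol.le hδ hBad h1 h2
  refine ⟨δ, η, coreZero_of_core hcore le_rfl hBad, ?_, hη, hηs⟩
  simpa only [inv_mul_cancel_left₀ hvol.ne'] using h1.mul_left vol⁻¹

/-- **ANY H1L PRODUCER OF NE7-PROPER PRODUCES N14's BINDER ON ITS OWN WINDOW**: the H1L face `NE7.PathLeaf l₀ vol T Bad P Q δ` (`NE7.core_of_pathLeaf`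
BY NAME) for MGF-form cores gives `TiltedMeanMatching l₀` at the Markov price (p497552's `tiltedMeanMatching_of_pathLeaf`: inner windows). [folklore] -/
theorem tiltedMeanMatching_of_pathLeaf_closedWindow (hP : MGFForm B T F ν P) (hQ : MGFForm B T F' ν' Q) (h : NE7.PathLeaf l₀ vol T Bad P Q δ)
    (hl₀ : 0 < l₀) (hvol : 0 ≤ vol) (hδ : ∀ K, 0 ≤ δ K) (hBad : ∀ K (t u : ℝ), |t| ≤ l₀ → |u| ≤ l₀ → Bad K u ⊆ Bad K t) :
    TiltedMeanMatching l₀ T Bad F ν F' ν' fun K =>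
      64 * Real.exp (2 + 2 * (2 * Real.exp 1 - 1) * l₀ * B) * (vol * δ K) * (1 + Real.posLog (2 * (vol * δ K))⁻¹) ^ 2 /
        (l₀ * Real.log (Real.exp 1 + Real.posLog (2 * (vol * δ K))⁻¹) ^ 2) :=
  tiltedMeanMatching_of_core_closedWindow hP hQ (NE7.core_of_pathLeaf h) hl₀ hvol hδ hBad

/-- **AT THE NODE's SHAPE `HybridNE7`, ON THE NODE's WINDOW**: its `core` field on the shell-free cores `A − shA`, `B − shB` (`NE7.core_of_hybridNE7` BY NAME),
in MGF form, gives `TiltedMeanMatching l₀` — the SAME `l₀` the node's DECL target `MatchingModConstants vol l₀ δ Z` carries (p497552's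
`tiltedMeanMatching_of_hybridNE7`: inner windows `l₁ < l₀`). [folklore] -/
theorem tiltedMeanMatching_of_hybridNE7_closedWindow {A Bf shA shB : ℕ → ℝ → ι → ℝ} {W Wsh : ℕ → ℝ}
    (hP : MGFForm B T F ν fun K t τ => A K t τ - shA K t τ) (hQ : MGFForm B T F' ν' fun K t τ => Bf K t τ - shB K t τ)
    (h : T4MatchingAssembly.HybridNE7 l₀ vol T A Bf Bad W shA shB Wsh δ) (hl₀ : 0 < l₀) (hvol : 0 ≤ vol) (hδ : ∀ K, 0 ≤ δ K)
    (hBad : ∀ K (t u : ℝ), |t| ≤ l₀ → |u| ≤ l₀ → Bad K u ⊆ Bad K t) :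
    TiltedMeanMatching l₀ T Bad F ν F' ν' fun K =>
      64 * Real.exp (2 + 2 * (2 * Real.exp 1 - 1) * l₀ * B) * (vol * δ K) * (1 + Real.posLog (2 * (vol * δ K))⁻¹) ^ 2 /
        (l₀ * Real.log (Real.exp 1 + Real.posLog (2 * (vol * δ K))⁻¹) ^ 2) :=
  tiltedMeanMatching_of_core_closedWindow hP hQ (NE7.core_of_hybridNE7 h) hl₀ hvol hδ hBad

end Leaf

end Summit.QuantumFields.YangMills.Theorems.BalabanUVNodesN19TiltedPriceClosedWindowSummable

end
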